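import Summits.QuantumFields.BalabanUV.Beta.FP.ConstrainedBiLaplacianResponseTwoLevelSymbols

/-!
# `BalabanUV.Beta.FP.ConstrainedBiLaplacianResponseTwoLevelEstimate` — road «FP» for binder row D1, DESIGN ROW **GHOST-STEP** brick (g3)
# «(CONV-C)-Hb», THE CONVERGENCE HALF, FILE 6c — THE CORE ESTIMATE: `‖betaT n L 2 p k − beta n 2 p k‖ ≤ Cb(d,L)∕n²` UNIFORMLY in the coarse
# alias `k` on `Strip d (kappaB d 2)`, hence the SYMBOL of the one-step law of the block-sum response:
# `‖Σ_ρ hM (n·L) 2 (Tsub τ ρ) p − hM n 2 τ p‖ ≤ n^{−d}·Cb·HF(n)∕n²` for every `n, L ≥ 1` (`HF(n) ≍ (48 log n)^d`, the lineage's entrywise price)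

NOT IN PRINT; OUR PROOF ATTEMPT (binder row G-an2-4 ∕ (CONV-C), prover part P3 = fibre∕strip «Woodbury» lineage, gen 28; CRUX TEAM (2),
2026-08-21).  HONEST DEPENDENCY (cell records, verbatim): «continuum YM on T⁴ ⇐ BetaPertH ∧ nine spine estimates (0/9 proved); BetaPertH ⇐ (D1) ∧
(D4) ∧ CAP+tail; G-an2-4 gates asym, D1 and NE2/3/4.»  HONEST FRAMING (cell contract, verbatim): «discharging `BetaPertH` makes Bałaban's UV
stability UNCONDITIONAL — a real constructive-QFT result; it is NOT the continuum limit and NOT the Clay problem.»  ABSOLUTE RULE (cell charter,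
verbatim): «No internally-minted statement may enter as a cited fact. Every hypothesis is either kernel-proved in this package or a verbatim quotation
of a PUBLISHED theorem with page reference. The manuscript(s) under audit are NOT citable for their own disputed steps — they are the thing under
adjudication; programme-internal (2001/route/tribunal) claims are never citable.»  THIS MODULE is [folklore] inequality bookkeeping over FILES 6a∕6b of
this programme and the lineage's `SubAveragingKernel.HF`∕`sum_norm_F_le`; it cites nothing as a hypothesis, has ONE bookkeeping `def` (the constant `Cb`),
no `def … : Prop`, no `sorry`.

## Contents

`Cb`, `norm_inv_den_sub_le` (`‖1∕den_{nL} − 1∕den_n‖ ≤ Cden∕(cB²n²)` on the strip), **`norm_betaT_sub_beta_le`** (the zero alias through FILE 6b's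
`norm_W1_zero_sub_one_le` + `norm_T2far_le`; a nonzero alias through `norm_T2_sub_le` + `norm_DeltaXi_sq_sub_le`; both through the denominators),
**`norm_sum_hM_Tsub_sub_hM_le`**: `‖Σ_ρ hM (n·L) 2 (Tsub τ ρ) p − hM n 2 τ p‖ ≤ ((n:ℝ)^d)⁻¹·(Cb d L·HF n d)∕n²` on the strip (FILE 6a's
`sum_hM_Tsub_sub_hM` + `Σ_k ‖F n τ k‖ ≤ HF`).  The kernel form (strip regularity of the difference, `latticeKernel_decay`) and the junction with
d1-p3's `Hb` are FILE 6d.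

0∕4 row-D1 binders touched.  NOT (CONV-C), NEVER «G-an2-4 closed», NOT the ghost step law, NOT SDF, NOT D1, NOT BetaPertH, NOT continuum, NOT Clay.
Provenance: prover-b2b-balaban-gan24-p3-g28-0 (unit `b2b-balaban-gan24-p3`, gen 28), 2026-08-21; no existing file touched.
-/

noncomputable section

namespace Summit.QuantumFields.BalabanUV.Beta.FP.ConstrainedBiLaplacianResponseTwoLevelEstimate

open Complex Finset ComplexConjugate
open Literature.MathematicalPhysics.QuantumFieldTheory.Balaban1983to89
open Literature.MathematicalPhysics.QuantumFieldTheory.Balaban1983to89.B4Strip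
open Literature.MathematicalPhysics.QuantumFieldTheory.Balaban1983to89.B4StripCauchy
open Literature.MathematicalPhysics.QuantumFieldTheory.Balaban1983to89.B5Strip145Analytic
open Literature.MathematicalPhysics.QuantumFieldTheory.Balaban1983to89.B4StripSums
open Summit.QuantumFields.BalabanUV.Beta.FP.ConstrainedBiLaplacianStrip
open Summit.QuantumFields.BalabanUV.Beta.FP.ConstrainedBiLaplacianFibre
open Summit.QuantumFields.BalabanUV.Beta.FP.ConstrainedBiLaplacianFibreEntries
open Summit.QuantumFields.BalabanUV.Beta.FP.ConstrainedBiLaplacianFibreSides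
open Summit.QuantumFields.BalabanUV.Beta.FP.ConstrainedBiLaplacianKernel
open Summit.QuantumFields.BalabanUV.Beta.FP.ConstrainedBiLaplacianFibreIdentities
open Summit.QuantumFields.BalabanUV.Beta.FP.ConstrainedBiLaplacianResponse
open Summit.QuantumFields.BalabanUV.Beta.FP.ConstrainedBiLaplacianResponseTwoLevel
open Summit.QuantumFields.BalabanUV.Beta.FP.ConstrainedBiLaplacianResponseTwoLevelSymbols
open Summit.QuantumFields.BalabanUV.Beta.GAN24.SubAveragingKernel (Tsub HF HF_nonneg sum_norm_F_le)
open Summit.QuantumFields.BalabanUV.Beta.GAN24.SubAveragingDirichlet (sw)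
open Summit.QuantumFields.BalabanUV.Beta.GAN24.SubAveragingCore (Kof Kof_val Kof_ne_zero Mstar W_Kof_far W_Kof_mstar)
open Summit.QuantumFields.BalabanUV.Beta.GAN24.SubAveragingCoreEstimate (W1 norm_W1_le Om Om_le Om_le' norm_A_sub_A'_le norm_W1_mstar_sub_one_le)
open Summit.QuantumFields.BalabanUV.Beta.GAN24.SubAveragingFibre (Kof_zero Mstar_zero norm_DeltaXi_mul_sub_le)
open scoped Real

variable {d : ℕ}

/-! ## §3 The transferred components against the coarse ones -/

/-- [folklore] The constant of `norm_betaT_sub_beta_le`. -/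
def Cb (d L : ℕ) : ℝ :=
  ((16 * (d : ℝ)) ^ 2 * C2 d L + 16384 * (d : ℝ) ^ 2 * (64 / 7) ^ 2 + 4 ^ d * 91 * (d : ℝ)
    + (16 * (d : ℝ)) ^ 2 * ((L : ℝ) ^ d * 4 ^ (d + 2) * (64 / 7) ^ 2)) / cB d
  + ((16 * (d : ℝ)) ^ 2 * (64 / 7) ^ 2 + 1) * Cden d L / cB d ^ 2

/-- [folklore] `0 ≤ Cb`. -/
theorem Cb_nonneg (d L : ℕ) : 0 ≤ Cb d L := by
  unfold Cb; have := C2_nonneg d L; have := Cden_nonneg d L; have := cB_pos d; positivity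

/-- [folklore] the reciprocal denominators at the two levels agree to `Cden∕(cB²·n²)` on the strip. -/
theorem norm_inv_den_sub_le (n L : ℕ) [NeZero n] [NeZero L] {p : Fin d → ℂ} (hp : p ∈ Strip d (kappaB d 2)) :
    ‖(den (n * L) 2 p)⁻¹ - (den n 2 p)⁻¹‖ ≤ Cden d L / cB d ^ 2 / (n : ℝ) ^ 2 := by
  have hfat : p ∈ Fat d (rOf d) := fat_of_strip 2 hp
  have hcB := cB_pos d
  have hd1 : cB d ≤ ‖den n 2 p‖ := norm_den_ge_strip n 2 p hp
  have hd2 : cB d ≤ ‖den (n * L) 2 p‖ := norm_den_ge_strip (n * L) 2 p hp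
  have hne1 : den n 2 p ≠ 0 := norm_pos_iff.mp (lt_of_lt_of_le hcB hd1)
  have hne2 : den (n * L) 2 p ≠ 0 := norm_pos_iff.mp (lt_of_lt_of_le hcB hd2)
  have e : (den (n * L) 2 p)⁻¹ - (den n 2 p)⁻¹ = (den n 2 p - den (n * L) 2 p) / (den (n * L) 2 p * den n 2 p) := by
    field_simp
  rw [e, norm_div, norm_mul, norm_sub_rev]
  have h := norm_den_sub_den_le n L (rOf_le d) (d_mul_rOf_sq_le d) hfat
  rw [div_le_iff₀ (by positivity)]
  calc ‖den (n * L) 2 p - den n 2 p‖ ≤ Cden d L / (n : ℝ) ^ 2 := h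
    _ = Cden d L / cB d ^ 2 / (n : ℝ) ^ 2 * (cB d * cB d) := by field_simp
    _ ≤ Cden d L / cB d ^ 2 / (n : ℝ) ^ 2 * (‖den (n * L) 2 p‖ * ‖den n 2 p‖) := by
        have := Cden_nonneg d L
        gcongr

/-- [folklore] **THE CORE ESTIMATE OF THE CONVERGENCE HALF**: for EVERY coarse alias `k` and every `p ∈ Strip d (kappaB d 2)`,
`‖betaT n L 2 p k − beta n 2 p k‖ ≤ Cb d L∕n²`. -/
theorem norm_betaT_sub_beta_le (n L : ℕ) [NeZero n] [NeZero L] {p : Fin d → ℂ} (hp : p ∈ Strip d (kappaB d 2)) (k : Fin d → Fin n) :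
    ‖betaT n L 2 p k - beta n 2 p k‖ ≤ Cb d L / (n : ℝ) ^ 2 := by
  have hn : 1 ≤ n := Nat.pos_of_ne_zero (NeZero.ne n)
  have hnL : 1 ≤ n * L := Nat.pos_of_ne_zero (NeZero.ne (n * L))
  have hn0 : (0 : ℝ) < n := by exact_mod_cast hn
  have hfat : p ∈ Fat d (rOf d) := fat_of_strip 2 hp
  have hr := rOf_le d
  have hdr := d_mul_rOf_sq_le d
  have hcB := cB_pos d
  have hd2 : cB d ≤ ‖den (n * L) 2 p‖ := norm_den_ge_strip (n * L) 2 p hp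
  have hne2 : den (n * L) 2 p ≠ 0 := norm_pos_iff.mp (lt_of_lt_of_le hcB hd2)
  have hinv2 : ‖(den (n * L) 2 p)⁻¹‖ ≤ (cB d)⁻¹ := by rw [norm_inv]; exact inv_anti₀ hcB hd2
  have hA' : ‖DeltaXi (n * L) 0 p‖ ≤ 16 * d := by have := norm_DeltaXi_le (n * L) hnL 0 le_rfl hr hfat; rwa [add_zero] at this
  have hA : ‖DeltaXi n 0 p‖ ≤ 16 * d := by have := norm_DeltaXi_le n hn 0 le_rfl hr hfat; rwa [add_zero] at this
  have hinvd := norm_inv_den_sub_le n L hp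
  have hC2 := C2_nonneg d L
  have hCden := Cden_nonneg d L
  have hX0 : (4 ^ d * 91 * (d : ℝ) + (16 * (d : ℝ)) ^ 2 * ((L : ℝ) ^ d * 4 ^ (d + 2) * (64 / 7) ^ 2)) / cB d + Cden d L / cB d ^ 2 ≤ Cb d L := by
    unfold Cb
    refine add_le_add (div_le_div_of_nonneg_right ?_ hcB.le) ?_
    · have : 0 ≤ (16 * (d : ℝ)) ^ 2 * C2 d L := by positivity
      have : 0 ≤ 16384 * (d : ℝ) ^ 2 * (64 / 7 : ℝ) ^ 2 := by positivity
      linarith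
    · rw [mul_div_assoc]
      have : 0 ≤ Cden d L / cB d ^ 2 := by positivity
      nlinarith [sq_nonneg (16 * (d : ℝ))]
  have hX1 : ((16 * (d : ℝ)) ^ 2 * C2 d L + 16384 * (d : ℝ) ^ 2 * (64 / 7) ^ 2) / cB d + (16 * (d : ℝ)) ^ 2 * (64 / 7) ^ 2 * (Cden d L / cB d ^ 2)
      ≤ Cb d L := by
    unfold Cb
    refine add_le_add (div_le_div_of_nonneg_right ?_ hcB.le) ?_
    · have : 0 ≤ 4 ^ d * 91 * (d : ℝ) := by positivity
      have : 0 ≤ (16 * (d : ℝ)) ^ 2 * ((L : ℝ) ^ d * 4 ^ (d + 2) * (64 / 7 : ℝ) ^ 2) := by positivity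
      linarith
    · rw [mul_div_assoc]
      have : 0 ≤ Cden d L / cB d ^ 2 := by positivity
      nlinarith
  by_cases hk : k = fun _ => 0
  · -- the zero alias
    subst hk
    rw [betaT_zero, beta_zero]
    have e : (W1 n L (Kof n L (fun _ => 0) (fun _ => 0)) p + DeltaXi (n * L) 0 p ^ 2 * T2far n L 2 p) / den (n * L) 2 p - 1 / den n 2 p
        = ((W1 n L (Kof n L (fun _ => 0) (fun _ => 0)) p - 1) + DeltaXi (n * L) 0 p ^ 2 * T2far n L 2 p) * (den (n * L) 2 p)⁻¹
          + ((den (n * L) 2 p)⁻¹ - (den n 2 p)⁻¹) := by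
      field_simp
      ring
    rw [e]
    have h1 : ‖((W1 n L (Kof n L (fun _ => 0) (fun _ => 0)) p - 1) + DeltaXi (n * L) 0 p ^ 2 * T2far n L 2 p) * (den (n * L) 2 p)⁻¹‖
        ≤ (4 ^ d * 91 * (d : ℝ) / (n : ℝ) ^ 2 + (16 * (d : ℝ)) ^ 2 * ((L : ℝ) ^ d * 4 ^ (d + 2) * (64 / 7) ^ 2 / (n : ℝ) ^ 2)) * (cB d)⁻¹ := by
      rw [norm_mul]
      refine mul_le_mul ((norm_add_le _ _).trans (add_le_add (norm_W1_zero_sub_one_le n L hr hfat) ?_)) hinv2 (norm_nonneg _) (by positivity)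
      rw [norm_mul, norm_pow]
      exact mul_le_mul (pow_le_pow_left₀ (norm_nonneg _) hA' 2) (norm_T2far_le n L hr hdr hfat) (norm_nonneg _) (by positivity)
    refine (norm_add_le _ _).trans ((add_le_add h1 hinvd).trans ?_)
    calc (4 ^ d * 91 * (d : ℝ) / (n : ℝ) ^ 2 + (16 * (d : ℝ)) ^ 2 * ((L : ℝ) ^ d * 4 ^ (d + 2) * (64 / 7) ^ 2 / (n : ℝ) ^ 2)) * (cB d)⁻¹
          + Cden d L / cB d ^ 2 / (n : ℝ) ^ 2
        = ((4 ^ d * 91 * (d : ℝ) + (16 * (d : ℝ)) ^ 2 * ((L : ℝ) ^ d * 4 ^ (d + 2) * (64 / 7) ^ 2)) / cB d + Cden d L / cB d ^ 2) / (n : ℝ) ^ 2 := by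
          field_simp
      _ ≤ Cb d L / (n : ℝ) ^ 2 := by gcongr
  · -- a nonzero alias
    rw [betaT_of_ne n L 2 p hk, beta_of_ne n 2 p hk]
    have hak : ‖ainv n 2 k p‖ ≤ (64 / 7) ^ 2 := by
      have h := norm_ainv_le n 2 hr hdr hfat k hk
      have hW1 := one_le_W n k hk
      refine h.trans (pow_le_pow_left₀ (div_nonneg (by norm_num) (by linarith)) ?_ 2)
      rw [div_le_iff₀ (by linarith)]; nlinarith
    have e : DeltaXi (n * L) 0 p ^ 2 / den (n * L) 2 p * T2 n L 2 p k - DeltaXi n 0 p ^ 2 * ainv n 2 k p / den n 2 p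
        = (DeltaXi (n * L) 0 p ^ 2 * (T2 n L 2 p k - ainv n 2 k p) + (DeltaXi (n * L) 0 p ^ 2 - DeltaXi n 0 p ^ 2) * ainv n 2 k p)
            * (den (n * L) 2 p)⁻¹
          + DeltaXi n 0 p ^ 2 * ainv n 2 k p * ((den (n * L) 2 p)⁻¹ - (den n 2 p)⁻¹) := by
      field_simp
      ring
    rw [e]
    have h1 : ‖(DeltaXi (n * L) 0 p ^ 2 * (T2 n L 2 p k - ainv n 2 k p) + (DeltaXi (n * L) 0 p ^ 2 - DeltaXi n 0 p ^ 2) * ainv n 2 k p)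
          * (den (n * L) 2 p)⁻¹‖
        ≤ ((16 * (d : ℝ)) ^ 2 * (C2 d L / (n : ℝ) ^ 2) + (16384 * (d : ℝ) ^ 2 / (n : ℝ) ^ 2) * (64 / 7) ^ 2) * (cB d)⁻¹ := by
      rw [norm_mul]
      refine mul_le_mul ((norm_add_le _ _).trans (add_le_add ?_ ?_)) hinv2 (norm_nonneg _) (by positivity)
      · rw [norm_mul, norm_pow]
        exact mul_le_mul (pow_le_pow_left₀ (norm_nonneg _) hA' 2) (norm_T2_sub_le n L hr hdr hfat hk) (norm_nonneg _) (by positivity)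
      · rw [norm_mul]
        exact mul_le_mul (norm_DeltaXi_sq_sub_le n L hr hfat) hak (norm_nonneg _) (by positivity)
    have h2 : ‖DeltaXi n 0 p ^ 2 * ainv n 2 k p * ((den (n * L) 2 p)⁻¹ - (den n 2 p)⁻¹)‖
        ≤ ((16 * (d : ℝ)) ^ 2 * (64 / 7) ^ 2) * (Cden d L / cB d ^ 2 / (n : ℝ) ^ 2) := by
      rw [norm_mul, norm_mul, norm_pow]
      exact mul_le_mul (mul_le_mul (pow_le_pow_left₀ (norm_nonneg _) hA 2) hak (norm_nonneg _) (by positivity)) hinvd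
        (norm_nonneg _) (by positivity)
    refine (norm_add_le _ _).trans ((add_le_add h1 h2).trans ?_)
    calc ((16 * (d : ℝ)) ^ 2 * (C2 d L / (n : ℝ) ^ 2) + 16384 * (d : ℝ) ^ 2 / (n : ℝ) ^ 2 * (64 / 7) ^ 2) * (cB d)⁻¹
          + (16 * (d : ℝ)) ^ 2 * (64 / 7) ^ 2 * (Cden d L / cB d ^ 2 / (n : ℝ) ^ 2)
        = (((16 * (d : ℝ)) ^ 2 * C2 d L + 16384 * (d : ℝ) ^ 2 * (64 / 7) ^ 2) / cB d + (16 * (d : ℝ)) ^ 2 * (64 / 7) ^ 2 * (Cden d L / cB d ^ 2))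
            / (n : ℝ) ^ 2 := by
          field_simp
      _ ≤ Cb d L / (n : ℝ) ^ 2 := by gcongr

/-- [folklore] **THE SYMBOL OF THE ONE-STEP LAW OF THE BLOCK-SUM RESPONSE** (order 2): on `Strip d (kappaB d 2)`, for every `n, L ≥ 1` and cell `τ`,
`‖Σ_ρ hM (n·L) 2 (Tsub τ ρ) p − hM n 2 τ p‖ ≤ ((n:ℝ)^d)⁻¹·(Cb d L·HF n d)∕n²`. -/
theorem norm_sum_hM_Tsub_sub_hM_le (n L : ℕ) [NeZero n] [NeZero L] {p : Fin d → ℂ} (hp : p ∈ Strip d (kappaB d 2)) (τ : Fin d → Fin n) :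
    ‖∑ ρ : Fin d → Fin L, hM (n * L) 2 (Tsub n L τ ρ) p - hM n 2 τ p‖ ≤ ((n : ℝ) ^ d)⁻¹ * (Cb d L * HF n d / (n : ℝ) ^ 2) := by
  have hfat : p ∈ Fat d (rOf d) := fat_of_strip 2 hp
  have hCb := Cb_nonneg d L
  rw [sum_hM_Tsub_sub_hM, norm_mul, norm_inv, norm_pow, Complex.norm_natCast]
  refine mul_le_mul_of_nonneg_left ?_ (by positivity)
  calc ‖∑ k : Fin d → Fin n, F n τ k p * (betaT n L 2 p k - beta n 2 p k)‖
      ≤ ∑ k : Fin d → Fin n, ‖F n τ k p * (betaT n L 2 p k - beta n 2 p k)‖ := norm_sum_le _ _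
    _ ≤ ∑ k : Fin d → Fin n, ‖F n τ k p‖ * (Cb d L / (n : ℝ) ^ 2) := Finset.sum_le_sum fun k _ => by
        rw [norm_mul]; exact mul_le_mul_of_nonneg_left (norm_betaT_sub_beta_le n L hp k) (norm_nonneg _)
    _ = (∑ k : Fin d → Fin n, ‖F n τ k p‖) * (Cb d L / (n : ℝ) ^ 2) := by rw [Finset.sum_mul]
    _ ≤ HF n d * (Cb d L / (n : ℝ) ^ 2) := mul_le_mul_of_nonneg_right (sum_norm_F_le n (rOf_le d) hfat τ) (by positivity)
    _ = Cb d L * HF n d / (n : ℝ) ^ 2 := by ring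

end Summit.QuantumFields.BalabanUV.Beta.FP.ConstrainedBiLaplacianResponseTwoLevelEstimate

end
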